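import Mathlib.Combinatorics.SetFamily.FourFunctions
import Mathlib.Tactic
import HarnessLib
import HarnessLib.Audit.Tags
import Summits.CriticalPhenomena.PercolationContinuityZ3.Theorems.PercNearOneGluingNoHeavyLowerTailSahiColouredDaykinMJ

/-!
# `NoHeavyLowerTail` (crux stmt-CriticalPhenomena-4575), master-family line P1 (gen 31): CONJECTURE MJ IS FALSE — `¬ CrossMeetJoin (Fin 8)`

Support file (seat `prim-masterthm-p1`, gen 31; `--supports stmt-CriticalPhenomena-4575`).  No `sorry`, standard axioms; two private definitions (the witness).
`SahiColouredDaykin.CrossMeetJoin` (typed the same day, p419227: "in a crossing configuration with all colour classes of size ≥ 2 the cross-colour meets and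
complemented cross-colour joins number at least `#P`") holds on every crossing configuration of `2^n`, `n ≤ 6` (447 151 200 of them) but is FALSE:
PRODUCT-STRUCTURED large classes defeat it.  Mechanism (memo §7): if `X` is a product family `{K ∪ α ∪ β : α ∈ 𝒜, β ∈ ℬ}` over two regions and the four
members of the two small classes each contain one region and avoid the other, then every cross meet / co-join with `X` is a function of `α` alone or of `β`
alone, so `#(crossColMeets ∪ crossColCoJoins) ≤ 3(#𝒜 + #ℬ) + 6` while `#P = #𝒜·#ℬ + 4` — negative margin as soon as `(#𝒜−3)(#ℬ−3) > 11`; annealing then finds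
the smallest instances.  THE WITNESS (found by `code-g31/mjanneal3.c`, verified independently by `code-g31/verify_cex8.py`): `F = Fin 8`,
`P₀ = {1234, 1245, 125, 12, 123457, 1235, 12457, 12345, 1247, 124, 12347, 123}` (colour 0), `P₁ = {256, 2356}`, `P₂ = {1456, 156}`: crossing, class sizes
(12, 2, 2), and `crossColMeets ∪ crossColCoJoins = {0, 03, 0347, 037, 047, 07, 1, 14, 145, 15, 2, 23, 235, 25, 56}` has 15 < 16 = #P members.
WHAT SURVIVES: `CrossSignedColouredDaykin3` itself (the within-colour differences restore the count: slack 15 here, 58 on the (81,2,2) product example),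
the reduction `crossSignedColouredDaykin3_of_crossMeetJoin` (now vacuous), MJ on `2^≤6`, and MJ for BALANCED class sizes (dimension-free SAT, memo §5–§7).
HONEST FRAMING: a refutation of this seat's own conjecture, by an explicit kernel-checked instance. [this work]
-/

namespace Summit.CriticalPhenomena.PercolationContinuityZ3.Theorems.SahiColouredDaykin

open Finset

/-- The 16 members of the counterexample on `Fin 8`. [this work] -/
private def mjCexP : Finset (Finset (Fin 8)) :=
  { {1,2,3,4}, {1,2,4,5}, {1,2,5}, {1,2}, {1,2,3,4,5,7}, {1,2,3,5}, {1,2,4,5,7}, {1,2,3,4,5}, {1,2,4,7}, {1,2,4}, {1,2,3,4,7}, {1,2,3},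
    {2,5,6}, {2,3,5,6}, {1,4,5,6}, {1,5,6} }

/-- Its colouring: `{256, 2356} ↦ 1`, `{1456, 156} ↦ 2`, everything else `↦ 0`. [this work] -/
private def mjCexC (S : Finset (Fin 8)) : Fin 3 :=
  if S = {2,5,6} ∨ S = {2,3,5,6} then 1 else if S = {1,4,5,6} ∨ S = {1,5,6} then 2 else 0

set_option maxRecDepth 16384 in
/-- **Conjecture MJ is false: `¬ CrossMeetJoin (Fin 8)`.**  The configuration `mjCexP`/`mjCexC` is crossing with class sizes (12,2,2) and has only 15
cross-colour meets / complemented cross-colour joins for its 16 members. [this work] -/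
theorem not_crossMeetJoin_fin8 : ¬ CrossMeetJoin (Fin 8) := by
  intro h
  have h1 : ∀ S ∈ mjCexP, S ⊆ (univ : Finset (Fin 8)) := fun S _ => subset_univ S
  have h2 : ∀ S ∈ mjCexP, ∀ T ∈ mjCexP, mjCexC S ≠ mjCexC T → ¬ S ⊆ T := by decide
  have h3 : ∀ S ∈ mjCexP, ∀ T ∈ mjCexP, (S ∩ T).Nonempty ∧ S ∪ T ≠ (univ : Finset (Fin 8)) := by decide
  have h4 : ∀ i : Fin 3, 2 ≤ #(mjCexP.filter fun S => mjCexC S = i) := by decide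
  have h5 : ¬ #mjCexP ≤ #(crossColMeets mjCexP mjCexC ∪ crossColCoJoins univ mjCexP mjCexC) := by decide
  exact h5 (h univ mjCexP mjCexC h1 h2 h3 h4)

end Summit.CriticalPhenomena.PercolationContinuityZ3.Theorems.SahiColouredDaykin
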